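import Mathlib
import HarnessLib
import Summits.HodgeConjecture.FermatCycles.CubicDoorSixtyNinePrym

/-!
# Fermat cycles — `(10, 69)`: kernel appendix to PCLASS (no FAMILY-P plane for the four quadric fibrations of the cubic door `W₆₉`)

HONEST FRAMING: explicit algebraic cycles for specific Hodge classes on Fermat/Delsarte varieties;
residual open instances listed; no claim on general Hodge.

Cell `pub-hfermat`, track FIND-THE-CLASS, seat ftc-engine gen-11; companion of the cell file `ftc/certs/W69/PCLASS.md` (ENGINE v10).
Setting (PRYM-DETECT §2 (iv), DOORTWIST §4): for each of the four classes `I` of coordinate `ℙ⁵`'s in `W₆₉`, the discriminant of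
the residual-quadric fibration over `ℙ⁴(y')` is `det A'_I · y_w³ + D₀'_I`, and the Prym double cover has the cyclic model
`Y₆ : w⁶ = f_I := −det A'_I · D₀'_I²`.  A FAMILY-P surface is a surface `S ⊂ ℙ⁴` over which `Y₆` splits up to a twist,
`f_I|_S = u·g⁶`.  PCLASS proves (hand proof + two machine methods) that NO PLANE is FAMILY-P, over any field of characteristic `0`,
for any of `I₁..I₄`.  The algebra that proof rests on is recorded here for the kernel:

* the four NORM-FORM DECOMPOSITIONS `−det A'_I = S_I² − 4·N_I` with `N_I` a sextic MONOMIAL (so the ruling cover `t² = −det A'` is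
  `(S − t)(S + t) = 4N`), for the explicit polynomials of `ftc/certs/W69/disc.json` (`detA₁`, `detA₃` are the gen-9 definitions of
  `CubicDoorSixtyNinePrym`; `detA₂`, `detA₄` are defined here);
* the converse half of the UFD lemma (`F_A + F_B = S`, `F_A F_B = N` ⇒ `S² − 4N = (F_A − F_B)²`), valid in every commutative ring;
* for class `I₃` on the quadric cone `K = {y₆y₁₀ = y₃y₉}` (which contains the only η-planes, the two cone rulings): with
  `σ := y₄²y₉ − y₃²y₁₀`, `−det A'₃ = σ²` and `σ · D₀'₃ = −(y₃y₄y₆) · σ³` — so the cube condition on a cone plane is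
  'the restriction of `y₃y₄y₆` is a constant times a cube of a linear form';
* and the two elementary facts that close the argument: neither `x·y·z` nor `x²·y` is a constant times the cube of a linear form
  (as functions on `F³`, `F` any field — hence a fortiori as polynomials), which are the shapes of `(y₃y₄y₆)|_P` on the two rulings.
Nothing here is a cycle, a class or a Hodge-theoretic statement: `(10,69)` is OPEN.  References: the cell files named above;
[Shioda1979HodgeFermat] Thm I for the ambient character calculus.
-/

namespace Summit.HodgeConjecture.FermatCycles.FamilyPPlanes

open Summit.HodgeConjecture.FermatCycles.CubicDoorSixtyNinePrym

/-! ### The four norm-form decompositions `−det A'_I = S_I² − 4 N_I` -/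

/-- `det A'(y')` for `I₂ = {0,1,2,5,6,9}` — variables `y₃, y₄, y₇, y₈, y₁₀` (`disc.json`, class 2: the `y_w³`-coefficient). [folklore] -/
def detA₂ (y3 y4 y7 y8 y10 : ℤ) : ℤ :=
  -1 * y3 ^ 4 * y7 ^ 2 - 2 * y3 ^ 2 * y4 * y7 * y8 ^ 2 - 2 * y3 ^ 2 * y7 * y8 * y10 ^ 2 - 1 * y4 ^ 2 * y8 ^ 4
    + 2 * y4 * y8 ^ 3 * y10 ^ 2 - 1 * y8 ^ 2 * y10 ^ 4

/-- `det A'(y')` for `I₄ = {0,1,2,5,7,9}` — variables `y₃, y₄, y₆, y₈, y₁₀` (`disc.json`, class 4). [folklore] -/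
def detA₄ (y3 y4 y6 y8 y10 : ℤ) : ℤ :=
  -1 * y3 ^ 4 * y6 ^ 2 - 2 * y3 ^ 2 * y4 ^ 2 * y6 * y8 - 2 * y3 ^ 2 * y4 * y6 * y10 ^ 2 - 1 * y4 ^ 4 * y8 ^ 2
    + 2 * y4 ^ 3 * y8 * y10 ^ 2 - 1 * y4 ^ 2 * y10 ^ 4

/-- `I₁`: `−det A'₁ = S² − 4N` with `S = y₃²y₉`, `N = y₃y₄²y₈y₉y₁₀` (PCLASS §0 (A)). [folklore] -/
theorem detA₁_norm (y3 y4 y8 y9 y10 : ℤ) :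
    -detA₁ y3 y4 y8 y9 y10 = (y3 ^ 2 * y9) ^ 2 - 4 * (y3 * y4 ^ 2 * y8 * y9 * y10) := by
  unfold detA₁; ring

/-- `I₂`: `−det A'₂ = S² − 4N` with `S = y₃²y₇ + y₄y₈² + y₈y₁₀²`, `N = y₄y₈³y₁₀²` (PCLASS §0 (A)). [folklore] -/
theorem detA₂_norm (y3 y4 y7 y8 y10 : ℤ) :
    -detA₂ y3 y4 y7 y8 y10 = (y3 ^ 2 * y7 + y4 * y8 ^ 2 + y8 * y10 ^ 2) ^ 2 - 4 * (y4 * y8 ^ 3 * y10 ^ 2) := by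
  unfold detA₂; ring

/-- `I₃`: `−det A'₃ = S² − 4N` with `S = y₃²y₁₀ + y₄²y₉`, `N = y₃y₄²y₆y₁₀²` (PCLASS §0 (A)). [folklore] -/
theorem detA₃_norm (y3 y4 y6 y9 y10 : ℤ) :
    -detA₃ y3 y4 y6 y9 y10 = (y3 ^ 2 * y10 + y4 ^ 2 * y9) ^ 2 - 4 * (y3 * y4 ^ 2 * y6 * y10 ^ 2) := by
  unfold detA₃; ring

/-- `I₄`: `−det A'₄ = S² − 4N` with `S = y₃²y₆ + y₄²y₈ + y₄y₁₀²`, `N = y₄³y₈y₁₀²` (PCLASS §0 (A)). [folklore] -/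
theorem detA₄_norm (y3 y4 y6 y8 y10 : ℤ) :
    -detA₄ y3 y4 y6 y8 y10 = (y3 ^ 2 * y6 + y4 ^ 2 * y8 + y4 * y10 ^ 2) ^ 2 - 4 * (y4 ^ 3 * y8 * y10 ^ 2) := by
  unfold detA₄; ring

/-! ### The UFD lemma, ring-theoretic half -/

/-- Converse half of the UFD lemma (PCLASS §1 (b)): a splitting `S = F_A + F_B`, `F_A·F_B = N` makes `S² − 4N` the square
`(F_A − F_B)²`.  (The direct half — every square arises this way on a factorial ring — is the unique-factorisation argument
of the memo and is not formalised here.) [folklore] -/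
theorem sq_sub_four_mul_of_split {R : Type*} [CommRing R] (S N FA FB : R) (hS : FA + FB = S) (hN : FA * FB = N) :
    S ^ 2 - 4 * N = (FA - FB) ^ 2 := by
  subst hS; subst hN; ring

/-- The norm-form reading used throughout: `(S − t)(S + t) = S² − t²`, so `t² = S² − 4N` says `(S − t)(S + t) = 4N`. [folklore] -/
theorem norm_form_reading {R : Type*} [CommRing R] (S N t : R) (h : t ^ 2 = S ^ 2 - 4 * N) :
    (S - t) * (S + t) = 4 * N := by
  linear_combination (-1 : R) * h

/-! ### Class `I₃` on the quadric cone `K = {y₆ y₁₀ = y₃ y₉}` (home of the only η-planes: the two cone rulings) -/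

/-- On `K`: `−det A'₃ = σ²` with `σ = y₄²y₉ − y₃²y₁₀` — the ruling double cover splits, untwisted (from gen-9's `detA₃_on_K`). [folklore] -/
theorem neg_detA₃_on_K_sq (y3 y4 y6 y9 y10 : ℤ) (h : y6 * y10 = y3 * y9) :
    -detA₃ y3 y4 y6 y9 y10 = (y4 ^ 2 * y9 - y3 ^ 2 * y10) ^ 2 := by
  rw [detA₃_on_K _ _ _ _ _ h]; ring

/-- On `K`: `σ · D₀'₃ = −(y₃ y₄ y₆) · σ³` (PCLASS §2 (iii)): the cube stage on a cone plane `P` asks whether `(y₃y₄y₆)|_P` is a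
constant times a cube (from gen-9's `D0₃_on_K`). [folklore] -/
theorem sigma_mul_D0₃_on_K (y3 y4 y6 y9 y10 : ℤ) (h : y6 * y10 = y3 * y9) :
    (y4 ^ 2 * y9 - y3 ^ 2 * y10) * D0₃ y3 y4 y6 y9 y10 = -(y3 * y4 * y6) * (y4 ^ 2 * y9 - y3 ^ 2 * y10) ^ 3 := by
  rw [D0₃_on_K _ _ _ _ _ h]; ring

/-- The ruling `R₂(α) = {y₃ = α y₁₀, y₆ = α y₉}` lies on `K`. [folklore] -/
theorem ruling_R2_on_K (α y9 y10 : ℤ) : (α * y9) * y10 = (α * y10) * y9 := by ring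

/-- The ruling `R₁(α) = {y₆ = α y₃, y₉ = α y₁₀}` lies on `K`. [folklore] -/
theorem ruling_R1_on_K (α y3 y10 : ℤ) : (α * y3) * y10 = y3 * (α * y10) := by ring

/-- On `R₂(α)` with plane coordinates `(s, t, u) = (y₁₀, y₄, y₉)`: `(y₃ y₄ y₆)|_P = α² · (s t u)` — shape `x·y·z`. [folklore] -/
theorem c0_on_R2 (α s t u : ℤ) : (α * s) * t * (α * u) = α ^ 2 * (s * t * u) := by ring

/-- On `R₁(α)` with plane coordinates `(s, t, u) = (y₃, y₄, y₁₀)`: `(y₃ y₄ y₆)|_P = α · (s² t)` — shape `x²·y`. [folklore] -/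
theorem c0_on_R1 (α s t : ℤ) : s * t * (α * s) = α * (s ^ 2 * t) := by ring

/-! ### The two non-cubes -/

/-- `x·y·z` is not a constant times the cube of a linear form — already as functions on `F³` for any field `F`
(evaluate at `(1,0,0)`, `(0,1,0)`, `(0,0,1)`, `(1,1,1)`), hence not as polynomials either (PCLASS §2 (iii), ruling `R₂`). [folklore] -/
theorem xyz_not_const_mul_cube {F : Type*} [Field F] :
    ¬ ∃ c a b d : F, ∀ x y z : F, x * y * z = c * (a * x + b * y + d * z) ^ 3 := by
  rintro ⟨c, a, b, d, h⟩
  have h1 := h 1 0 0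
  have h2 := h 0 1 0
  have h3 := h 0 0 1
  have h4 := h 1 1 1
  simp only [mul_one, mul_zero, add_zero, zero_add] at h1 h2 h3 h4
  -- h1 : 0 = c * a ^ 3, h2 : 0 = c * b ^ 3, h3 : 0 = c * d ^ 3, h4 : 1 = c * (a + b + d) ^ 3
  rcases mul_eq_zero.mp h1.symm with hc | ha
  · rw [hc, zero_mul] at h4; exact one_ne_zero h4
  rcases mul_eq_zero.mp h2.symm with hc | hb
  · rw [hc, zero_mul] at h4; exact one_ne_zero h4
  rcases mul_eq_zero.mp h3.symm with hc | hd
  · rw [hc, zero_mul] at h4; exact one_ne_zero h4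
  have ha' : a = 0 := pow_eq_zero_iff (n := 3) (by norm_num) |>.mp ha
  have hb' : b = 0 := pow_eq_zero_iff (n := 3) (by norm_num) |>.mp hb
  have hd' : d = 0 := pow_eq_zero_iff (n := 3) (by norm_num) |>.mp hd
  rw [ha', hb', hd'] at h4
  norm_num at h4

/-- `x²·y` is not a constant times the cube of a linear form — as functions on `F³` for any field `F`
(evaluate at `(1,0,0)`, `(0,1,0)`, `(0,0,1)`, `(1,1,0)`) (PCLASS §2 (iii), ruling `R₁`). [folklore] -/
theorem xxy_not_const_mul_cube {F : Type*} [Field F] :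
    ¬ ∃ c a b d : F, ∀ x y z : F, x ^ 2 * y = c * (a * x + b * y + d * z) ^ 3 := by
  rintro ⟨c, a, b, d, h⟩
  have h1 := h 1 0 0
  have h2 := h 0 1 0
  have h3 := h 0 0 1
  have h4 := h 1 1 0
  simp only [mul_one, mul_zero, add_zero, zero_add, one_pow, ne_eq, OfNat.ofNat_ne_zero,
    not_false_eq_true, zero_pow] at h1 h2 h3 h4
  rcases mul_eq_zero.mp h1.symm with hc | ha
  · rw [hc, zero_mul] at h4; exact one_ne_zero h4
  rcases mul_eq_zero.mp h2.symm with hc | hb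
  · rw [hc, zero_mul] at h4; exact one_ne_zero h4
  have ha' : a = 0 := pow_eq_zero_iff (n := 3) (by norm_num) |>.mp ha
  have hb' : b = 0 := pow_eq_zero_iff (n := 3) (by norm_num) |>.mp hb
  rw [ha', hb'] at h4
  norm_num at h4

end Summit.HodgeConjecture.FermatCycles.FamilyPPlanes
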